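import Mathlib
import HarnessLib
import Summits.CriticalPhenomena.PercolationContinuityZ3.Theses.PercTreeValue
import Literature.Probability.Percolation.TwoPointFunction
import Literature.Probability.Percolation.RSW

/-!
# `stub_boxRestriction_of_coreRestriction` — link L1 of line `Sketch` (rev c2)
# (crux `TetrahedronDisjointCoexistence`, stmt-CriticalPhenomena-7798)

Registered link stub L1 (rev c2) of the lead's skeleton
`Cruxes/TetrahedronDisjointCoexistence/Lines/Sketch.lean`, landed DEF-FREE over tree declarations.

With `a_r = (r,r,0)` and `k = ⌊r/8⌋`: CORE RESTRICTION (the open stub `stub_coreRestriction`, S5,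
`P(0 ↔ a_r inside Core_r) ≥ c τ(0,a_r)` for the cube `Core_r = [−k, r+k]² × [−(r+k), k]`) implies BOX
RESTRICTION (the rev-c2 residue `stub_boxRestriction`, S5', verbatim conclusion, for the box
`Box_r = [−r, 2r]² × [−2r, 3k]`), with the SAME constant `c` and threshold `r₀`.

Proof. For every `r : ℕ` one has `0 ≤ k = ⌊r/8⌋ ≤ r`, hence `Core_r ⊆ Box_r`; restricted connection
events are monotone in the region (`openConnIn_mono`) and the measure is monotone (`measureReal_mono`).
So the rev-c2 residue S5' is (formally) WEAKER than the c1 residue S5.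
-/

noncomputable section

namespace Summit.CriticalPhenomena.PercolationContinuityZ3.Theorems.TetrahedronDisjointCoexistence

open MeasureTheory
open Literature.Probability.Percolation Literature.Probability.LatticeModels

/-- For every `r` the core cube `Core_r = [−k, r+k]² × [−(r+k), k]`, `k = ⌊r/8⌋`, lies in the box
`Box_r = [−r, 2r]² × [−2r, 3k]` (indeed `0 ≤ ⌊r/8⌋ ≤ r`). -/
theorem linkBoxOfCore_core_subset_box (r : ℕ) :
    {x : Site 3 | -((r : ℤ) / 8) ≤ x 0 ∧ x 0 ≤ (r : ℤ) + (r : ℤ) / 8 ∧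
        -((r : ℤ) / 8) ≤ x 1 ∧ x 1 ≤ (r : ℤ) + (r : ℤ) / 8 ∧
        -((r : ℤ) + (r : ℤ) / 8) ≤ x 2 ∧ x 2 ≤ (r : ℤ) / 8} ⊆
      {x : Site 3 | -(r : ℤ) ≤ x 0 ∧ x 0 ≤ 2 * (r : ℤ) ∧ -(r : ℤ) ≤ x 1 ∧ x 1 ≤ 2 * (r : ℤ) ∧
        -(2 * (r : ℤ)) ≤ x 2 ∧ x 2 ≤ 3 * ((r : ℤ) / 8)} := by
  intro x hx
  simp only [Set.mem_setOf_eq] at hx ⊢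
  omega

/-- **Link L1 (registered stub of line `Sketch`, rev c2).** Core restriction (S5) implies box
restriction (S5', verbatim conclusion): since `Core_r ⊆ Box_r` for every `r`,
`P(0 ↔_{Box_r} a_r) ≥ P(0 ↔_{Core_r} a_r) ≥ c τ(0,a_r)` for `r ≥ r₀`; same `c`, same `r₀`. -/
theorem stub_boxRestriction_of_coreRestriction
    (hCore : ∃ c : ℝ, 0 < c ∧ ∃ r₀ : ℕ, ∀ r : ℕ, r₀ ≤ r →
      c * tau 3 (criticalProbI 3) 0 ![(r : ℤ), (r : ℤ), 0] ≤
        (bondPercolation (zdGraph 3) (criticalProbI 3)).real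
          (openConnIn
            {x : Site 3 | -((r : ℤ) / 8) ≤ x 0 ∧ x 0 ≤ (r : ℤ) + (r : ℤ) / 8 ∧
              -((r : ℤ) / 8) ≤ x 1 ∧ x 1 ≤ (r : ℤ) + (r : ℤ) / 8 ∧
              -((r : ℤ) + (r : ℤ) / 8) ≤ x 2 ∧ x 2 ≤ (r : ℤ) / 8}
            (0 : Site 3) ![(r : ℤ), (r : ℤ), 0])) :
    ∃ c : ℝ, 0 < c ∧ ∃ r₀ : ℕ, ∀ r : ℕ, r₀ ≤ r →
      c * tau 3 (criticalProbI 3) 0 ![(r : ℤ), (r : ℤ), 0] ≤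
        (bondPercolation (zdGraph 3) (criticalProbI 3)).real
          (openConnIn
            {x : Site 3 | -(r : ℤ) ≤ x 0 ∧ x 0 ≤ 2 * (r : ℤ) ∧ -(r : ℤ) ≤ x 1 ∧ x 1 ≤ 2 * (r : ℤ) ∧
              -(2 * (r : ℤ)) ≤ x 2 ∧ x 2 ≤ 3 * ((r : ℤ) / 8)}
            (0 : Site 3) ![(r : ℤ), (r : ℤ), 0]) := by
  obtain ⟨c, hc, r₀, hC⟩ := hCore
  refine ⟨c, hc, r₀, fun r hr => ?_⟩
  exact le_trans (hC r hr)
    (measureReal_mono (openConnIn_mono (linkBoxOfCore_core_subset_box r) _ _))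

end Summit.CriticalPhenomena.PercolationContinuityZ3.Theorems.TetrahedronDisjointCoexistence

end
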